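import Mathlib
import Literature.AlgebraicGeometry.Resolution.PointBlowupFlagDropMonomialStep
import Summits.ResolutionOfSingularities.ResolutionOfSingularities.Theorems.WeightedInvariantLocalWeightedDropWildMonicFlagDropAxisSplit
import Summits.ResolutionOfSingularities.ResolutionOfSingularities.Theorems.WeightedInvariantLocalWeightedDropWildMonicWClean
import Summits.ResolutionOfSingularities.ResolutionOfSingularities.Theorems.WeightedInvariantLocalWeightedDropWildPurePowerFlagStepZero

/-!
# S3ρ flag line, (D2) `DropAxisTangentFirst` — part A: THE AXIS SUCCESSOR IN NORMAL FORM as a monomial point step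
# (supports by `Ψ_{d−j}`, scaled Newton set by `Ψ_{d!}`, `w`-cleanness transported — Perlega Prop. 6.1.1 for the `dirChart 0` normal form)

Crux item stmt-ResolutionOfSingularities-8899 `LocalWeightedDrop` (route `ResolutionOfSingularities/WeightedInvariant`), engine of the
door `HypersurfaceCentreConstruction` stmt-ResolutionOfSingularities-19897.  [OURS · L1 W4.3, chain w43, res-D-pv-056 AS res-L1-w43-stub-5
on target (D2) `DropAxisTangentFirst` of res-type-083's `…WildMonicFlagDropAxisSplit` (HANDS 2026-08-27T08:21:00Z).  MAP: S. Perlega,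
arXiv:2011.14443 Ch. 6 §1.1 Prop. 6.1.1 («(1) `w′(J′₋₁) = w(J₋₁) − c!·w(x₁)`; (2) if `f` is `w`-clean … then `f′` is `w′`-clean»); the
lift-data version is res-D-pv-005 AS stub-7's `…WildMonicWClean` §PointStep (`isWClean_pointStep₀_iff`), of which this file is the port
to the successor NORMAL FORM `x^{d−j}·T_j = A_j(x, xy)` of res-type-083's `IsAxisStep` / `DropShape` (`PlaneGerm.dirChart 0`).  Every
object is OURS; nothing here is a statement of H. Hironaka's manuscript [claim: Hironaka2017, status: under-review].]

* `coeff_axisSucc_ne_zero_iff` — supports correspond: `[x^{β₀} y^{β₁}] T_j ≠ 0 ⟺ β₁ ≤ β₀ + (d−j) ∧ [x^{β₀+(d−j)−β₁} y^{β₁}] A_j ≠ 0`;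
* `newtonSet_axisSucc` — `newtonSet T = Ψ_{d!}(newtonSet A)` when `ord A_j ≥ d − j`;
* `weightedOrder_axisSucc_add`, `slotWOrd_axisSucc_add`, `wMin_axisSucc_add` — Prop. 6.1.1 (1) for the source weight `srcWeight w′`;
* `isWClean_axisSucc_iff` — Prop. 6.1.1 (2) as an equivalence: `T` is `w′`-clean iff `A` is `(w′₀, w′₀ + w′₁)`-clean.
-/

set_option linter.dupNamespace false -- mandated namespace of this single-conjunct summit

noncomputable section

namespace Summit.ResolutionOfSingularities.ResolutionOfSingularities.Theorems

namespace WildMonic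

open MvPowerSeries MonicDescent Literature.AlgebraicGeometry.Resolution

variable {k : Type} [Field k] {d : ℕ}

/-! ## Coefficients of `x^q · F` and of `F(x, xy)` -/

/-- Coefficients of `x^q · F` (`x = X 0`). -/
theorem coeff_X_zero_pow_mul (q : ℕ) (F : MvPowerSeries (Fin 2) k) (e : Fin 2 →₀ ℕ) :
    coeff e ((X 0 : MvPowerSeries (Fin 2) k) ^ q * F) = if q ≤ e 0 then coeff (e - Finsupp.single 0 q) F else 0 := by
  rw [MvPowerSeries.X_pow_eq, MvPowerSeries.coeff_monomial_mul, one_mul]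
  by_cases h : q ≤ e 0
  · rw [if_pos (Finsupp.single_le_iff.mpr h), if_pos h]
  · rw [if_neg (fun hle => h (Finsupp.single_le_iff.mp hle)), if_neg h]

/-- Coefficients of `x^q · F` at `e + q·(1,0)`. -/
theorem coeff_add_single_X_zero_pow_mul (q : ℕ) (F : MvPowerSeries (Fin 2) k) (e : Fin 2 →₀ ℕ) :
    coeff (e + Finsupp.single 0 q) ((X 0 : MvPowerSeries (Fin 2) k) ^ q * F) = coeff e F := by
  rw [coeff_X_zero_pow_mul, if_pos (by simp), add_tsub_cancel_right]

/-- Coefficients of `F(x, x(0 + y)) = F(x, xy)`: `[x^{m₀} y^{m₁}] = [x^{m₀−m₁} y^{m₁}] F` if `m₁ ≤ m₀`, else `0`. -/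
theorem coeff_subst_dirChart_zero (F : MvPowerSeries (Fin 2) k) (m : Fin 2 →₀ ℕ) :
    coeff m (subst (PlaneGerm.dirChart (0 : k)) F) =
      if m 1 ≤ m 0 then coeff (Finsupp.single 0 (m 0 - m 1) + Finsupp.single 1 (m 1)) F else 0 := by
  rw [PurePowerFlag.subst_dirChart_zero_eq]
  exact HauserPerlega2024.coeff_subst_step (0 : Fin 2) 1 (by decide) (fun l => by fin_cases l <;> simp) F m

/-! ## The axis successor in normal form -/

section AxisSucc

variable (A T : Fin d → MvPowerSeries (Fin 2) k)
  (hT : ∀ j : Fin d, (X 0 : MvPowerSeries (Fin 2) k) ^ (d - (j : ℕ)) * T j = subst (PlaneGerm.dirChart (0 : k)) (A j))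

include hT in
/-- SUPPORTS CORRESPOND UNDER `Ψ_{d−j}`: `[x^{β₀} y^{β₁}] T_j ≠ 0 ⟺ β₁ ≤ β₀ + (d−j) ∧ [x^{β₀+(d−j)−β₁} y^{β₁}] A_j ≠ 0`. -/
theorem coeff_axisSucc_ne_zero_iff (j : Fin d) (β : Fin 2 →₀ ℕ) :
    coeff β (T j) ≠ 0 ↔
      β 1 ≤ β 0 + (d - (j : ℕ)) ∧ coeff (Finsupp.single 0 (β 0 + (d - (j : ℕ)) - β 1) + Finsupp.single 1 (β 1)) (A j) ≠ 0 := by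
  have h := congrArg (coeff (β + Finsupp.single 0 (d - (j : ℕ)))) (hT j)
  rw [coeff_add_single_X_zero_pow_mul, coeff_subst_dirChart_zero] at h
  simp only [Finsupp.add_apply, Finsupp.single_eq_same, Finsupp.single_eq_of_ne (show (1 : Fin 2) ≠ 0 by decide),
    add_zero] at h
  rw [h]
  by_cases hle : β 1 ≤ β 0 + (d - (j : ℕ))
  · simp [hle]
  · simp [hle]

/-- A support exponent of a slot with `ord ≥ d − j` has total degree `≥ d − j`. -/
theorem sub_le_add_of_coeff_ne_zero {j : Fin d} (hA : ((d - (j : ℕ) : ℕ) : ℕ∞) ≤ (A j).order) {e : Fin 2 →₀ ℕ}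
    (he : coeff e (A j) ≠ 0) : d - (j : ℕ) ≤ e 0 + e 1 := by
  have h := hA.trans (order_le he)
  have hd : e.degree = e 0 + e 1 := by simp [Finsupp.degree_eq_sum, Fin.sum_univ_two]
  rwa [hd, Nat.cast_le] at h

include hT in
/-- The source exponent of a support point of the successor, as a `Ψ`-preimage. -/
theorem exists_psi_of_coeff_axisSucc_ne_zero (j : Fin d) {β : Fin 2 →₀ ℕ} (hβ : coeff β (T j) ≠ 0) :
    ∃ e : Fin 2 →₀ ℕ, coeff e (A j) ≠ 0 ∧ d - (j : ℕ) ≤ e 0 + e 1 ∧ psi (d - (j : ℕ)) e = β := by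
  rw [coeff_axisSucc_ne_zero_iff A T hT] at hβ
  refine ⟨_, hβ.2, ?_, ?_⟩
  · rw [pt_apply_zero, pt_apply_one]; omega
  · exact Literature.RingTheory.TwoVariableSeries.finsupp_fin2_ext
      (by rw [psi_apply_zero, pt_apply_zero, pt_apply_one]; omega) (by rw [psi_apply_one, pt_apply_one])

include hT in
/-- Conversely, a support exponent of the source with `e₀ + e₁ ≥ d − j` gives the support exponent `Ψ_{d−j} e` of the successor. -/
theorem coeff_psi_axisSucc_ne_zero (j : Fin d) {e : Fin 2 →₀ ℕ} (he : coeff e (A j) ≠ 0) (hq : d - (j : ℕ) ≤ e 0 + e 1) :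
    coeff (psi (d - (j : ℕ)) e) (T j) ≠ 0 := by
  rw [coeff_axisSucc_ne_zero_iff A T hT, psi_apply_zero, psi_apply_one]
  refine ⟨by omega, ?_⟩
  have hee : Finsupp.single 0 (e 0 + e 1 - (d - (j : ℕ)) + (d - (j : ℕ)) - e 1) + Finsupp.single 1 (e 1) = e :=
    Literature.RingTheory.TwoVariableSeries.finsupp_fin2_ext (by rw [pt_apply_zero]; omega) (by rw [pt_apply_one])
  rw [hee]
  exact he

include hT in
/-- The support of the successor slot is the `Ψ_{d−j}`-image of the support of the source slot. -/
theorem setOf_coeff_axisSucc_ne_zero (j : Fin d) (hA : ((d - (j : ℕ) : ℕ) : ℕ∞) ≤ (A j).order) :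
    {β : Fin 2 →₀ ℕ | coeff β (T j) ≠ 0} = psi (d - (j : ℕ)) '' {e : Fin 2 →₀ ℕ | coeff e (A j) ≠ 0} := by
  ext β
  simp only [Set.mem_setOf_eq, Set.mem_image]
  constructor
  · intro hβ
    obtain ⟨e, he, -, rfl⟩ := exists_psi_of_coeff_axisSucc_ne_zero A T hT j hβ
    exact ⟨e, he, rfl⟩
  · rintro ⟨e, he, rfl⟩
    exact coeff_psi_axisSucc_ne_zero A T hT j he (sub_le_add_of_coeff_ne_zero A hA he)

include hT in
/-- **THE SCALED NEWTON SET OF THE AXIS SUCCESSOR IS `Ψ_{d!}` OF THAT OF THE PARENT** (no monomial dropped when `ord A_j ≥ d − j`). -/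
theorem newtonSet_axisSucc (hA : ∀ j : Fin d, ((d - (j : ℕ) : ℕ) : ℕ∞) ≤ (A j).order) :
    newtonSet T = psi d.factorial '' newtonSet A := by
  ext P
  simp only [mem_newtonSet_iff, Set.mem_image]
  constructor
  · rintro ⟨j, β, hβ, rfl⟩
    obtain ⟨e, he, hq, rfl⟩ := exists_psi_of_coeff_axisSucc_ne_zero A T hT j hβ
    exact ⟨slotWeight d j • e, ⟨j, e, he, rfl⟩, by rw [smul_psi, slotWeight_mul_sub]⟩
  · rintro ⟨Q, ⟨j, e, he, rfl⟩, rfl⟩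
    exact ⟨j, psi (d - (j : ℕ)) e, coeff_psi_axisSucc_ne_zero A T hT j he (sub_le_add_of_coeff_ne_zero A (hA j) he),
      by rw [smul_psi, slotWeight_mul_sub]⟩

include hT in
/-- PERLEGA PROP. 6.1.1 (1), SLOT BY SLOT: `ord_{w′}(T_j) + w′₀·(d − j) = ord_w(A_j)` for the source weight `w = srcWeight w′`. -/
theorem weightedOrder_axisSucc_add (w' : Fin 2 → ℕ) (j : Fin d) (hA : ((d - (j : ℕ) : ℕ) : ℕ∞) ≤ (A j).order) :
    (T j).weightedOrder w' + ((w' 0 * (d - (j : ℕ)) : ℕ) : ℕ∞) = (A j).weightedOrder (srcWeight w') := by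
  rw [weightedOrder_eq_iInf_coeff, weightedOrder_eq_iInf_coeff, setOf_coeff_axisSucc_ne_zero A T hT j hA, iInf_image,
    ENat.iInf_add]
  refine iInf_congr fun e => ?_
  rw [ENat.iInf_add]
  refine iInf_congr fun he => ?_
  rw [← ENat.coe_add, weight_psi_add w' (sub_le_add_of_coeff_ne_zero A hA he)]

include hT in
/-- The scaled slot orders: `slotWOrd w′ T j + w′₀·d! = slotWOrd (srcWeight w′) A j`. -/
theorem slotWOrd_axisSucc_add (w' : Fin 2 → ℕ) (j : Fin d) (hA : ((d - (j : ℕ) : ℕ) : ℕ∞) ≤ (A j).order) :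
    slotWOrd w' T j + ((w' 0 * d.factorial : ℕ) : ℕ∞) = slotWOrd (srcWeight w') A j := by
  unfold slotWOrd
  rw [← weightedOrder_axisSucc_add A T hT w' j hA, mul_add, ← slotWeight_mul_sub j]
  push_cast
  ring

include hT in
/-- PERLEGA PROP. 6.1.1 (1): `m′ + w′₀·d! = m`. -/
theorem wMin_axisSucc_add (w' : Fin 2 → ℕ) (hA : ∀ j : Fin d, ((d - (j : ℕ) : ℕ) : ℕ∞) ≤ (A j).order) :
    wMin w' T + ((w' 0 * d.factorial : ℕ) : ℕ∞) = wMin (srcWeight w') A := by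
  unfold wMin
  rw [ENat.iInf_add]
  exact iInf_congr fun j => slotWOrd_axisSucc_add A T hT w' j (hA j)

include hT in
/-- The `w′`-initial exponents of the successor slot are the `Ψ_{d−j}`-images of the `w`-initial exponents of the source slot. -/
theorem mem_initSupp_axisSucc_iff (w' : Fin 2 → ℕ) (j : Fin d) (hA : ((d - (j : ℕ) : ℕ) : ℕ∞) ≤ (A j).order) (β : Fin 2 →₀ ℕ) :
    β ∈ initSupp w' (T j) ↔ ∃ e ∈ initSupp (srcWeight w') (A j), psi (d - (j : ℕ)) e = β := by
  have hord := weightedOrder_axisSucc_add A T hT w' j hA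
  constructor
  · rintro ⟨hβ, hw⟩
    obtain ⟨e, he, hq, rfl⟩ := exists_psi_of_coeff_axisSucc_ne_zero A T hT j hβ
    refine ⟨e, ⟨he, ?_⟩, rfl⟩
    rw [← hord, ← hw, ← ENat.coe_add, weight_psi_add w' hq]
  · rintro ⟨e, ⟨he, hw⟩, rfl⟩
    have hq := sub_le_add_of_coeff_ne_zero A hA he
    refine ⟨coeff_psi_axisSucc_ne_zero A T hT j he hq, ?_⟩
    have h2 : ((Finsupp.weight w' (psi (d - (j : ℕ)) e) : ℕ) : ℕ∞) + ((w' 0 * (d - (j : ℕ)) : ℕ) : ℕ∞) =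
        (T j).weightedOrder w' + ((w' 0 * (d - (j : ℕ)) : ℕ) : ℕ∞) := by
      rw [hord, ← hw, ← ENat.coe_add, weight_psi_add w' hq]
    exact WithTop.add_right_cancel (ENat.coe_ne_top _) h2

include hT in
/-- **PERLEGA PROP. 6.1.1 (2) FOR THE AXIS SUCCESSOR IN NORMAL FORM** — an EQUIVALENCE: `T` is `w′`-clean iff `A` is clean for the
source weight `(w′₀, w′₀ + w′₁)`. [cite: Perlega2020, Prop. 6.1.1 (2) `w_clean_stable_under_blowup` (arXiv:2011.14443 Ch. 6 §1.1)] -/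
theorem isWClean_axisSucc_iff (p : ℕ) (w' : Fin 2 → ℕ) (hA : ∀ j : Fin d, ((d - (j : ℕ) : ℕ) : ℕ∞) ≤ (A j).order) :
    IsWClean p w' T ↔ IsWClean p (srcWeight w') A := by
  have hslot : ∀ j : Fin d, slotWOrd w' T j + ((w' 0 * d.factorial : ℕ) : ℕ∞) = slotWOrd (srcWeight w') A j :=
    fun j => slotWOrd_axisSucc_add A T hT w' j (hA j)
  have hmin := wMin_axisSucc_add A T hT w' hA
  have hfin : ((w' 0 * d.factorial : ℕ) : ℕ∞) ≠ ⊤ := ENat.coe_ne_top _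
  unfold IsWClean
  refine or_congr ?_ (or_congr ?_ ?_)
  · refine exists_congr fun i => and_congr Iff.rfl ?_
    rw [← hmin, ← hslot i]
    exact ⟨fun h => by rw [h], fun h => WithTop.add_right_cancel hfin h⟩
  · refine forall_congr' fun i => imp_congr Iff.rfl ?_
    rw [← hmin, ← hslot i]
    exact (ENat.add_lt_add_iff_right hfin).symm
  · constructor
    · rintro ⟨i, β, hi, hβ, hndvd⟩
      obtain ⟨e, he, rfl⟩ := (mem_initSupp_axisSucc_iff A T hT w' i (hA i) β).mp hβ
      have hq : d - (i : ℕ) ≤ e 0 + e 1 := sub_le_add_of_coeff_ne_zero A (hA i) he.1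
      have hqi : d - (i : ℕ) = qOf p d := by
        have := Nat.le_of_dvd (Fin.pos i) (qOf_dvd p d); omega
      refine ⟨i, e, hi, he, fun hdvd => hndvd ?_⟩
      rw [← hqi] at hdvd ⊢
      exact (dvd_psi_iff hq).mpr hdvd
    · rintro ⟨i, e, hi, he, hndvd⟩
      have hq : d - (i : ℕ) ≤ e 0 + e 1 := sub_le_add_of_coeff_ne_zero A (hA i) he.1
      have hqi : d - (i : ℕ) = qOf p d := by
        have := Nat.le_of_dvd (Fin.pos i) (qOf_dvd p d); omega
      refine ⟨i, psi (d - (i : ℕ)) e, hi, (mem_initSupp_axisSucc_iff A T hT w' i (hA i) _).mpr ⟨e, he, rfl⟩, fun hdvd => hndvd ?_⟩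
      rw [← hqi] at hdvd ⊢
      exact (dvd_psi_iff hq).mp hdvd

end AxisSucc

end WildMonic

end Summit.ResolutionOfSingularities.ResolutionOfSingularities.Theorems

end
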